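/-
Copyright (c) 2026 the pub-hodgecm-mathlib formalisation cell (harness21).  Prover seat hodgecm-mathlib-K2E1-p16 (g2), Track B ∕ K2-LIT, h413 = `stmt-HodgeConjecture-24833`,
route of record `HCCMUnconditional`; R90-TF section S8 «ContSpec-n½» (dealer R90-CS-plan (g0), LEAD K2E1-plan (g7)), «U(Φ₃) χ-TWIN row 4a» (TWIN-DAG v1 §B.4; RULING S8-R10 (b):
PAIR currency ★ D-S8-3 `K2E1CharacterEisensteinU3PairDefs`): the N = 3 twin of ★ `K2E1ChiIntertwinedSectionU2` (K2-defs1 (g6)) — the first LAW-BEARING twin.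
-/
import Summits.HodgeConjecture.HodgeConjecture.Theorems.K2E1CharacterEisensteinU3PairDefs   -- ★ p861816 D-S8-3 (K2-defs1 g7): `IsChiSectionPair`, `middleEntryUnitary`, `diagEntryUnit`, `conjAdele_diag_mul_diag_rev`; brings ★ `firstEntryUnit`, `reflectChar`
import Summits.HodgeConjecture.HodgeConjecture.Theorems.K2E1IntertwiningGrowthU3            -- ★ (K2E4-p11): N = 3 `borelHeight_weylLongU_mul_diag_mul`; brings ★ `K2E1MaassSelbergCMThreeIntertwined.flatSectionU_intertwinedCoeff` (`a − 2`), ★ `UnitaryGroupBorelModulusThree`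
import Summits.HodgeConjecture.HodgeConjecture.Theorems.K2E1IntertwinedSectionInvariance     -- ★ `integral_weyl_mul_unipotent_mul_three`; brings ★ `map_torusConj_eq_torusRootModulus_smul` (N = 3)
import HarnessLib

/-!
# S8 «U(Φ₃) χ-TWIN» row 4a — `K2E1ChiIntertwinedSectionU3`: THE INTERTWINED SECTION `M(z, (χ₁, χ₂))φ` OF `U(2,1)` IS A `(χ₁ʷ, χ₂)`-PAIR-SECTION — `g ↦ (∫_{N(𝔸)} f_z(w₀ v g) dν(v))·H(g)^{z−2}`
# satisfies `IsChiSectionPair (reflectChar c χ₁) χ₂ ·` (every `z`; no convergence hypothesis, no Euler product, no L-function) — the N = 3 twin of ★ `K2E1ChiIntertwinedSectionU2`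

Cell `pub/hodgecm-mathlib`, crux h413 = `stmt-HodgeConjecture-24833`; R90-TF section S8 (Rogawski 1990 §13.9; the U(Φ₃) χ-twins feed R1₃ of S8B#2's road and E-S8-def-cont), deal «rows 4–5
over D-S8-3» (R90-CS-plan 16:15:41Z).  THEOREMS ONLY (no `def`, no `instance`, no notation, no named-fact hypothesis, no `sorry`); lane `--supports stmt-HodgeConjecture-24833 --as helper`
(count-neutral).  Closes no socket.  Generic quadratic datum `(F, E, c)` with `c² = 1`, `c ≠ 1` (as the N = 2 original); rank `3`.

THE MATHEMATICS ([MoeglinWaldspurger1995, II.1.6–II.1.7]; [Rogawski1990, §1.10 (the torus `d(α, β, ᾱ⁻¹)`), §13.9 («χ = (φ, ψ) a unitary character of `M\𝐌`»)]; [Garrett2018, §2.8]).  On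
`U(J₃)`, `B = TN`, `T(𝔸) = {t = diag(d₀, d₁, d₂)}` with the torus relations `c(d₂)d₀ = 1`, `c(d₁)d₁ = 1` (★ `torus_relations`), so `t = d(α, β, ᾱ⁻¹)` with `β ∈ U(1)(𝔸)`.  The long Weyl
element `W = ι(w₀)` reverses the diagonal: `W t W⁻¹ = diag(d₂, d₁, d₀)` (§1), whence for a `(χ₁, χ₂)`-pair-section `φ` (★ `IsChiSectionPair`: `φ(b g) = χ₁(b₀₀)χ₂(b₁₁)φ(g)`):
`φ(W t y) = χ₁(d₂)·χ₂(d₁)·φ(W y) = χ₁ʷ(d₀)·χ₂(β)·φ(W y)` (`χ₁ʷ = reflectChar c χ₁`, `χ₁ʷ(a) = χ₁(c a)⁻¹`; the MIDDLE character is UNCHANGED — audit1 (n2)'s dictionary `w(χ₁, χ₂) = (χ₁^{−c}, χ₂)`),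
`H(W t y) = ‖d₀‖⁻¹H(W y)` (★ N = 3 `borelHeight_weylLongU_mul_diag_mul`), `(u ↦ t⁻¹ u t)_* ν = δ_B(t)·ν` with `δ_B(t) = ‖d₀‖²` (★ `map_torusConj_eq_torusRootModulus_smul`, ★
`torusRootModulus_three_eq`), `H(b g) = ‖d₂‖⁻¹H(g) = ‖d₀‖H(g)` (★ `distribHaarChar_torus_three`).  Hence `∫ f_z(W v b g) dν = ‖d₀‖²·χ₁ʷ(b₀₀)χ₂(b₁₁)·‖d₀‖^{−z}·∫ f_z(W v g) dν` (`b = t n`, ★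
`integral_weyl_mul_unipotent_mul_three`), and the exponents `‖d₀‖²·‖d₀‖^{−z}·(‖d₀‖)^{z−2} = 1` make `φ̃ := (M(w₀) f_z)·H^{z−2}` a `(χ₁ʷ, χ₂)`-pair-section — the N = 3 reflection is `z ↦ 2 − z`
(★ `flatSectionU_intertwinedCoeff`: `∫ f_z(W v g) dν = flatSectionU φ̃ (2 − z) g`).
* §1 `adelicVal_weylLongU_apply`, `glDiagonal_rev_eq_adelicVal_weylConj` (`W t W⁻¹ = diag(d ∘ rev)`), `torus_last_eq_conj_fst_inv` (`d₂ = (c d₀)⁻¹`), `chi_torus_last_eq_reflectChar`,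
  `middleEntryUnitary_weylConj` (the middle entry of `W t W⁻¹` is that of `t`).
* §2 `apply_weylLongU_torus_mul_of_isChiSectionPair`, `flatSectionU_weylLongU_torus_mul_of_isChiSectionPair`, `integral_flatSectionU_weylLongU_torus_mul_of_isChiSectionPair`.
* §3 HEAD **`isChiSectionPair_intertwinedCoeff_three`** (+ `flatSectionU_intertwinedCoeff_three_eq`: the `HasReflectedIntertwining`-shape second clause, ★ `flatSectionU_intertwinedCoeff` by
  name; a `HasReflectedIntertwiningPair` def at N = 3 is a K2-defs1 follow-up — none is declared here).
HONEST LABEL: HC_CM is proved only modulo the 7 printed citations (2 remaining named inputs: hLiu418 = `stmt-HodgeConjecture-24832`, h413 = `stmt-HodgeConjecture-24833`) until rung 0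
closes; this file asserts no named fact and closes no socket.  No automorphy of `χ₂` is used (only the torus law).

## References
* [MoeglinWaldspurger1995] C. Mœglin, J.-L. Waldspurger, *Spectral decomposition and Eisenstein series* (1995), II.1.6 (the intertwining operator `M(w, π)`), II.1.7.
* [Rogawski1990] J. D. Rogawski, *Automorphic Representations of Unitary Groups in Three Variables* (1990), §1.10 p. 9, §13.9 p. 229.
* [Garrett2018] P. Garrett, *Modern Analysis of Automorphic Forms by Example* 1 (2018), §2.8 (the intertwining integral and its torus equivariance).
-/

set_option autoImplicit false
-- the mandated namespace repeats the single-problem summit's segment (`HodgeConjecture.HodgeConjecture`)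
set_option linter.dupNamespace false

noncomputable section

open MeasureTheory Measure NumberField IsDedekindDomain Matrix
open scoped ENNReal NNReal MatrixGroups
open Literature.NumberTheory Literature.NumberTheory.Automorphic Literature.NumberTheory.Automorphic.UnitaryGroup AdelicGroupData
open Literature.NumberTheory.GaloisRepresentations (HeckeCharacter ideleGroup)
open Literature.NumberTheory.Automorphic.Arthur2013.Leaves.TECR
open Summit.HodgeConjecture.HodgeConjecture.Cruxes.H413.K2E1BorelEisensteinU
open Summit.HodgeConjecture.HodgeConjecture.Cruxes.H413.K2E1CharacterEisensteinU2Defs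
open Summit.HodgeConjecture.HodgeConjecture.Cruxes.H413.K2E1CharacterEisensteinU3PairDefs
open Summit.HodgeConjecture.HodgeConjecture.Cruxes.H413.K2E1IntertwinedSectionInvariance (integral_weyl_mul_unipotent_mul_three)
open Summit.HodgeConjecture.HodgeConjecture.Cruxes.H413.K2E1MaassSelbergBracketsThree (measurable_flatSectionU)
open Summit.HodgeConjecture.HodgeConjecture.Cruxes.H413.K2E1IntertwiningGrowthU3 (borelHeight_weylLongU_mul_diag_mul)
open Summit.HodgeConjecture.HodgeConjecture.Cruxes.H413.K2E1MaassSelbergCMThreeIntertwined (flatSectionU_intertwinedCoeff)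

namespace Summit.HodgeConjecture.HodgeConjecture.Cruxes.H413.K2E1ChiIntertwinedSectionU3

variable {F E : Type} [Field F] [NumberField F] [Field E] [NumberField E] [Algebra F E] {c : E ≃ₐ[F] E}

/-! ## §1 `W·diag(d₀,d₁,d₂)·W⁻¹ = diag(d₂,d₁,d₀)`, `d₂ = (c d₀)⁻¹`, `χ₁(d₂) = χ₁ʷ(d₀)` and the middle entry on the torus of `U(J₃)` -/

/-- The adelic matrix of `W = ι(w₀)` is `Φ₃`: `W i k = [k = rev i]` (★ `coe_coe_weylLongU`, ★ `StdForm.antidiagonal_over_apply`). [cite: MoeglinWaldspurger1995, I.2.2] -/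
theorem adelicVal_weylLongU_apply (i k : Fin 3) :
    (adelicVal F E c 3 _ ((quasiSplit F E c 3).toAdelic (weylLongU (c : E →+* E) (rfl : (StdForm.antidiagonal 3).over E = (StdForm.antidiagonal 3).over E))) : Matrix (Fin 3) (Fin 3) (AdeleRing (𝓞 E) E)) i k =
      if k = i.rev then 1 else 0 := by
  change algebraMap E (AdeleRing (𝓞 E) E)
      ((((weylLongU (c : E →+* E) (rfl : (StdForm.antidiagonal 3).over E = (StdForm.antidiagonal 3).over E) :
        ↥(unitaryGroupOfForm (c : E →+* E) ((StdForm.antidiagonal 3).over E))) : GL (Fin 3) E) : Matrix (Fin 3) (Fin 3) E) i k) = _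
  rw [coe_coe_weylLongU, StdForm.antidiagonal_over_apply]
  split_ifs <;> simp

/-- **`W·t·W⁻¹ = diag(d ∘ rev)`** for `t = diag(d) ∈ T(𝔸_F)` of `U(J₃)`: conjugation by the long Weyl element reverses the diagonal (so `W t W⁻¹ ∈ T(𝔸_F) ≤ B(𝔸_F)` with first entry `d₂` and
middle entry `d₁`). [cite: MoeglinWaldspurger1995, II.1.7] -/
theorem glDiagonal_rev_eq_adelicVal_weylConj {t : (quasiSplit F E c 3).Adelic} {d : Fin 3 → (AdeleRing (𝓞 E) E)ˣ} (hd : glDiagonal 3 (AdeleRing (𝓞 E) E) d = adelicVal F E c 3 _ t) :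
    glDiagonal 3 (AdeleRing (𝓞 E) E) (d ∘ Fin.rev) =
      adelicVal F E c 3 _ ((quasiSplit F E c 3).toAdelic (weylLongU (c : E →+* E) (rfl : (StdForm.antidiagonal 3).over E = (StdForm.antidiagonal 3).over E)) * t *
        ((quasiSplit F E c 3).toAdelic (weylLongU (c : E →+* E) (rfl : (StdForm.antidiagonal 3).over E = (StdForm.antidiagonal 3).over E)))⁻¹) := by
  rw [map_mul, map_inv, map_mul, ← hd, eq_mul_inv_iff_mul_eq]
  refine Units.ext (Matrix.ext fun i j => ?_)
  rw [Units.val_mul, Units.val_mul, coe_glDiagonal, coe_glDiagonal, Matrix.mul_apply, Matrix.mul_apply, Fin.sum_univ_three, Fin.sum_univ_three]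
  simp only [Matrix.diagonal_apply, adelicVal_weylLongU_apply, Function.comp_apply]
  fin_cases i <;> fin_cases j <;> simp [Fin.rev]

/-- **On the torus of `U(J₃)`, `d₂ = (c d₀)⁻¹`** as ideles (★ `torus_relations`: `c(d₀)·d₂ = 1`). [cite: Rogawski1990, §1.10] -/
theorem torus_last_eq_conj_fst_inv (t : ↥(torusInBorel F E c 3)) {d : Fin 3 → (AdeleRing (𝓞 E) E)ˣ}
    (hd : glDiagonal 3 (AdeleRing (𝓞 E) E) d = adelicVal F E c 3 _ ((t : borelAdelic F E c 3) : (quasiSplit F E c 3).Adelic)) :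
    d 2 = (Units.map (conjAdele F E c : AdeleRing (𝓞 E) E →+* AdeleRing (𝓞 E) E).toMonoidHom (d 0))⁻¹ := by
  obtain ⟨-, -, h02⟩ := torus_relations t hd
  have hu : Units.map (conjAdele F E c : AdeleRing (𝓞 E) E →+* AdeleRing (𝓞 E) E).toMonoidHom (d 0) * d 2 = 1 :=
    Units.ext (by rw [Units.val_mul, Units.coe_map, Units.val_one]; exact h02)
  exact eq_inv_of_mul_eq_one_right hu

/-- **`χ₁(d₂) = χ₁ʷ(d₀)`** on the torus of `U(J₃)` (`χ₁ʷ = reflectChar c χ₁`, `χ₁ʷ(a) = χ₁(c a)⁻¹`): the outer coordinate of the pair is reflected. [cite: MoeglinWaldspurger1995, II.1.7] -/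
theorem chi_torus_last_eq_reflectChar (χ₁ : HeckeCharacter E) (t : ↥(torusInBorel F E c 3)) {d : Fin 3 → (AdeleRing (𝓞 E) E)ˣ}
    (hd : glDiagonal 3 (AdeleRing (𝓞 E) E) d = adelicVal F E c 3 _ ((t : borelAdelic F E c 3) : (quasiSplit F E c 3).Adelic)) :
    χ₁ (d 2) = reflectChar c χ₁ (d 0) := by
  rw [torus_last_eq_conj_fst_inv t hd, map_inv, reflectChar_apply]

/-- **The middle entries of two Borel elements with the same middle diagonal coordinate agree in `T(𝔸_F)`** (`middleEntryUnitary` reads only `b₁₁`, ★ `coe_middleEntryUnitary`; the coercion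
`TorusDict.torus c → 𝕀_E` is injective). [cite: Rogawski1990, §1.10 p. 9] -/
theorem middleEntryUnitary_eq_of_apply_eq {b b' : (quasiSplit F E c 3).Adelic} (hb : b ∈ borelAdelic F E c 3) (hb' : b' ∈ borelAdelic F E c 3)
    (h : (adelicVal F E c 3 _ b : Matrix (Fin 3) (Fin 3) (AdeleRing (𝓞 E) E)) 1 1 = (adelicVal F E c 3 _ b' : Matrix (Fin 3) (Fin 3) (AdeleRing (𝓞 E) E)) 1 1) :
    middleEntryUnitary hb = middleEntryUnitary hb' := by
  apply Subtype.ext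
  rw [coe_middleEntryUnitary, coe_middleEntryUnitary]
  exact Units.ext (by rw [coe_diagEntryUnit, coe_diagEntryUnit, h])

/-- **The middle entry of `W t W⁻¹` is the middle entry of `t`** (`(d ∘ rev) 1 = d 1`): the Weyl reflection of `U(J₃)` FIXES the middle character of a pair (audit1 (n2): `w(χ₁, χ₂) = (χ₁^{−c}, χ₂)`).
[cite: MoeglinWaldspurger1995, II.1.7] [cite: Rogawski1990, §1.10 p. 9] -/
theorem middleEntryUnitary_weylConj (t : ↥(torusInBorel F E c 3)) {d : Fin 3 → (AdeleRing (𝓞 E) E)ˣ}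
    (hd : glDiagonal 3 (AdeleRing (𝓞 E) E) d = adelicVal F E c 3 _ ((t : borelAdelic F E c 3) : (quasiSplit F E c 3).Adelic))
    (hB : (quasiSplit F E c 3).toAdelic (weylLongU (c : E →+* E) (rfl : (StdForm.antidiagonal 3).over E = (StdForm.antidiagonal 3).over E)) * ((t : borelAdelic F E c 3) : (quasiSplit F E c 3).Adelic) *
        ((quasiSplit F E c 3).toAdelic (weylLongU (c : E →+* E) (rfl : (StdForm.antidiagonal 3).over E = (StdForm.antidiagonal 3).over E)))⁻¹ ∈ borelAdelic F E c 3) :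
    middleEntryUnitary hB = middleEntryUnitary (t : borelAdelic F E c 3).2 := by
  refine middleEntryUnitary_eq_of_apply_eq hB (t : borelAdelic F E c 3).2 ?_
  rw [← glDiagonal_rev_eq_adelicVal_weylConj hd, ← hd, coe_glDiagonal, coe_glDiagonal, Matrix.diagonal_apply_eq, Matrix.diagonal_apply_eq]
  rfl

/-! ## §2 The flat section and the intertwining integral under `W` and the torus, for a `(χ₁, χ₂)`-pair-section -/

section Scaling

variable [MeasurableSpace (quasiSplit F E c 3).Adelic] [BorelSpace (quasiSplit F E c 3).Adelic]

omit [MeasurableSpace (quasiSplit F E c 3).Adelic] [BorelSpace (quasiSplit F E c 3).Adelic] in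
/-- **`φ(W t y) = χ₁(d₂)·χ₂(t₁₁)·φ(W y)`** for a `(χ₁, χ₂)`-pair-section `φ` and `t = diag(d) ∈ T(𝔸_F)` (`W t = (W t W⁻¹) W`, §1). [cite: MoeglinWaldspurger1995, II.1.6] -/
theorem apply_weylLongU_torus_mul_of_isChiSectionPair {χ₁ : HeckeCharacter E} {χ₂ : ↥(TorusDict.torus c) →ₜ* ℂˣ} {φ : (quasiSplit F E c 3).Adelic → ℂ}
    (hφ : IsChiSectionPair χ₁ χ₂ φ) (t : ↥(torusInBorel F E c 3)) {d : Fin 3 → (AdeleRing (𝓞 E) E)ˣ}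
    (hd : glDiagonal 3 (AdeleRing (𝓞 E) E) d = adelicVal F E c 3 _ ((t : borelAdelic F E c 3) : (quasiSplit F E c 3).Adelic)) (y : (quasiSplit F E c 3).Adelic) :
    φ ((quasiSplit F E c 3).toAdelic (weylLongU (c : E →+* E) (rfl : (StdForm.antidiagonal 3).over E = (StdForm.antidiagonal 3).over E)) * (((t : borelAdelic F E c 3) : (quasiSplit F E c 3).Adelic) * y)) =
      ((χ₁ (d 2) : ℂˣ) : ℂ) * ((χ₂ (middleEntryUnitary (t : borelAdelic F E c 3).2) : ℂˣ) : ℂ) *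
        φ ((quasiSplit F E c 3).toAdelic (weylLongU (c : E →+* E) (rfl : (StdForm.antidiagonal 3).over E = (StdForm.antidiagonal 3).over E)) * y) := by
  set W : (quasiSplit F E c 3).Adelic := (quasiSplit F E c 3).toAdelic (weylLongU (c : E →+* E) (rfl : (StdForm.antidiagonal 3).over E = (StdForm.antidiagonal 3).over E)) with hW
  set T : (quasiSplit F E c 3).Adelic := ((t : borelAdelic F E c 3) : (quasiSplit F E c 3).Adelic) with hT
  have hd' := glDiagonal_rev_eq_adelicVal_weylConj hd
  have hB : W * T * W⁻¹ ∈ borelAdelic F E c 3 := torusAdelic_le_borelAdelic ⟨d ∘ Fin.rev, hd'⟩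
  have h0 : firstEntryUnit hB = d 2 := by
    refine Units.ext ?_
    rw [coe_firstEntryUnit, ← hd', coe_glDiagonal, Matrix.diagonal_apply_eq]
    rfl
  have h1 : middleEntryUnitary hB = middleEntryUnitary (t : borelAdelic F E c 3).2 := middleEntryUnitary_weylConj t hd hB
  rw [show W * (T * y) = (W * T * W⁻¹) * (W * y) by group, hφ.borel_mul hB, h0, h1]

omit [MeasurableSpace (quasiSplit F E c 3).Adelic] [BorelSpace (quasiSplit F E c 3).Adelic] in
/-- **`f_z(W t y) = χ₁(d₂)·χ₂(t₁₁)·((‖d₀‖⁻¹ : ℝ) : ℂ)^z·f_z(W y)`** (`H(W t y) = ‖d₀‖⁻¹ H(W y)`, ★ N = 3 `borelHeight_weylLongU_mul_diag_mul`). [cite: MoeglinWaldspurger1995, II.1.6] -/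
theorem flatSectionU_weylLongU_torus_mul_of_isChiSectionPair {χ₁ : HeckeCharacter E} {χ₂ : ↥(TorusDict.torus c) →ₜ* ℂˣ} {φ : (quasiSplit F E c 3).Adelic → ℂ}
    (hφ : IsChiSectionPair χ₁ χ₂ φ) (t : ↥(torusInBorel F E c 3)) {d : Fin 3 → (AdeleRing (𝓞 E) E)ˣ}
    (hd : glDiagonal 3 (AdeleRing (𝓞 E) E) d = adelicVal F E c 3 _ ((t : borelAdelic F E c 3) : (quasiSplit F E c 3).Adelic)) (z : ℂ) (y : (quasiSplit F E c 3).Adelic) :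
    flatSectionU φ z ((quasiSplit F E c 3).toAdelic (weylLongU (c : E →+* E) (rfl : (StdForm.antidiagonal 3).over E = (StdForm.antidiagonal 3).over E)) * (((t : borelAdelic F E c 3) : (quasiSplit F E c 3).Adelic) * y)) =
      ((χ₁ (d 2) : ℂˣ) : ℂ) * ((χ₂ (middleEntryUnitary (t : borelAdelic F E c 3).2) : ℂˣ) : ℂ) * ((((IdeleClassGroup.ideleNorm E (d 0))⁻¹ : ℝ≥0) : ℝ) : ℂ) ^ z *
        flatSectionU φ z ((quasiSplit F E c 3).toAdelic (weylLongU (c : E →+* E) (rfl : (StdForm.antidiagonal 3).over E = (StdForm.antidiagonal 3).over E)) * y) := by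
  rw [flatSectionU_apply, flatSectionU_apply, apply_weylLongU_torus_mul_of_isChiSectionPair hφ t hd y, borelHeight_weylLongU_mul_diag_mul hd, NNReal.coe_mul, Complex.ofReal_mul,
    Complex.mul_cpow_ofReal_nonneg (NNReal.coe_nonneg _) (NNReal.coe_nonneg _)]
  ring

/-- **TORUS SCALING OF THE INTERTWINING INTEGRAL OF A `(χ₁, χ₂)`-PAIR-SECTION**: `∫ f_z(W v t x) dν(v) = δ_B(t)·χ₁(d₂)χ₂(t₁₁)·(‖d₀‖⁻¹)^z·∫ f_z(W v x) dν(v)`, `δ_B(t) = torusRootModulus E 3 d`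
(substitute `v = t u t⁻¹`, ★ `map_torusConj_eq_torusRootModulus_smul`, then the previous lemma pointwise).  No convergence hypothesis. [cite: MoeglinWaldspurger1995, II.1.6] [cite: Garrett2018, §2.8] -/
theorem integral_flatSectionU_weylLongU_torus_mul_of_isChiSectionPair (hc : c * c = 1) (hc1 : c ≠ 1) (ν : Measure ↥(adelicUnipotent F E c 3)) [ν.IsHaarMeasure]
    {χ₁ : HeckeCharacter E} {χ₂ : ↥(TorusDict.torus c) →ₜ* ℂˣ} {φ : (quasiSplit F E c 3).Adelic → ℂ} (hφ : IsChiSectionPair χ₁ χ₂ φ) (hφm : Measurable φ)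
    (t : ↥(torusInBorel F E c 3)) {d : Fin 3 → (AdeleRing (𝓞 E) E)ˣ}
    (hd : glDiagonal 3 (AdeleRing (𝓞 E) E) d = adelicVal F E c 3 _ ((t : borelAdelic F E c 3) : (quasiSplit F E c 3).Adelic)) (z : ℂ) (x : (quasiSplit F E c 3).Adelic) :
    ∫ v : ↥(adelicUnipotent F E c 3), flatSectionU φ z ((quasiSplit F E c 3).toAdelic (weylLongU (c : E →+* E) (rfl : (StdForm.antidiagonal 3).over E = (StdForm.antidiagonal 3).over E)) *
        ((v : (quasiSplit F E c 3).Adelic) * (((t : borelAdelic F E c 3) : (quasiSplit F E c 3).Adelic) * x))) ∂ν =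
      ((torusRootModulus E 3 d : ℝ) : ℂ) * (((χ₁ (d 2) : ℂˣ) : ℂ) * ((χ₂ (middleEntryUnitary (t : borelAdelic F E c 3).2) : ℂˣ) : ℂ) * ((((IdeleClassGroup.ideleNorm E (d 0))⁻¹ : ℝ≥0) : ℝ) : ℂ) ^ z) *
        ∫ v : ↥(adelicUnipotent F E c 3), flatSectionU φ z ((quasiSplit F E c 3).toAdelic (weylLongU (c : E →+* E) (rfl : (StdForm.antidiagonal 3).over E = (StdForm.antidiagonal 3).over E)) *
          ((v : (quasiSplit F E c 3).Adelic) * x)) ∂ν := by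
  haveI := locallyCompactSpace_adeleRing' E
  letI : MeasurableSpace (AdeleRing (𝓞 E) E) := borel _
  haveI : BorelSpace (AdeleRing (𝓞 E) E) := ⟨rfl⟩
  set T : (quasiSplit F E c 3).Adelic := ((t : borelAdelic F E c 3) : (quasiSplit F E c 3).Adelic) with hT
  set W : (quasiSplit F E c 3).Adelic := (quasiSplit F E c 3).toAdelic (weylLongU (c : E →+* E) (rfl : (StdForm.antidiagonal 3).over E = (StdForm.antidiagonal 3).over E)) with hW
  -- the integrand as a function of `u = t⁻¹ v t`
  set Φ : ↥(adelicUnipotent F E c 3) → ℂ := fun u => flatSectionU φ z (W * (T * ((u : (quasiSplit F E c 3).Adelic) * x))) with hΦ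
  have hΦm : Measurable Φ :=
    (measurable_flatSectionU hφm z).comp (continuous_const.mul (continuous_const.mul (continuous_subtype_val.mul continuous_const))).measurable
  have hκ : Measurable fun u : ↥(adelicUnipotent F E c 3) => (⟨T⁻¹ * (u : (quasiSplit F E c 3).Adelic) * T,
      conj_mem_adelicUnipotent (t : borelAdelic F E c 3).2 u.2⟩ : ↥(adelicUnipotent F E c 3)) :=
    ((continuous_const.mul continuous_subtype_val).mul continuous_const).measurable.subtype_mk
  have h1 : (fun v : ↥(adelicUnipotent F E c 3) => flatSectionU φ z (W * ((v : (quasiSplit F E c 3).Adelic) * (T * x)))) =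
      fun v : ↥(adelicUnipotent F E c 3) => Φ (⟨T⁻¹ * (v : (quasiSplit F E c 3).Adelic) * T, conj_mem_adelicUnipotent (t : borelAdelic F E c 3).2 v.2⟩ : ↥(adelicUnipotent F E c 3)) := by
    funext v
    simp only [hΦ]
    rw [show T * (T⁻¹ * (v : (quasiSplit F E c 3).Adelic) * T * x) = (v : (quasiSplit F E c 3).Adelic) * (T * x) by group]
  have h2 : ∀ u : ↥(adelicUnipotent F E c 3), Φ u = (((χ₁ (d 2) : ℂˣ) : ℂ) * ((χ₂ (middleEntryUnitary (t : borelAdelic F E c 3).2) : ℂˣ) : ℂ) *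
      ((((IdeleClassGroup.ideleNorm E (d 0))⁻¹ : ℝ≥0) : ℝ) : ℂ) ^ z) * flatSectionU φ z (W * ((u : (quasiSplit F E c 3).Adelic) * x)) := fun u => by
    simp only [hΦ]
    rw [flatSectionU_weylLongU_torus_mul_of_isChiSectionPair hφ t hd z]
  rw [h1, ← integral_map hκ.aemeasurable hΦm.aestronglyMeasurable, map_torusConj_eq_torusRootModulus_smul hc hc1 ν t hd, integral_smul_measure, ENNReal.coe_toReal]
  simp_rw [h2]
  rw [integral_const_mul, Complex.real_smul]
  ring

/-! ## §3 HEAD: the intertwined coefficient `φ̃ = (M(w₀) f_z)·H^{z−2}` is a `(χ₁ʷ, χ₂)`-pair-section -/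

/-- **ROW 4a HEAD — `M(z, (χ₁, χ₂))φ` IS A `(χ₁ʷ, χ₂)`-PAIR-SECTION**: for a Borel `(χ₁, χ₂)`-pair-section `φ` of `U(J₃)` (`c² = 1`, `c ≠ 1`) and ANY `z`, the intertwined coefficient
`φ̃(g) := (∫_{N(𝔸)} f_z(W v g) dν(v))·H(g)^{z−2}` satisfies `φ̃(b g) = χ₁ʷ(b₀₀)·χ₂(b₁₁)·φ̃(g)` for every `b ∈ B(𝔸_F)`, `χ₁ʷ = reflectChar c χ₁` — Levi `b = t n` (★ `torusPart`), `N(𝔸)`-invariance (★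
`integral_weyl_mul_unipotent_mul_three`), §2 torus scaling with `δ_B(t) = ‖d₀‖²` (★ `torusRootModulus_three_eq`), `H(b g) = ‖d₂‖⁻¹H(g) = ‖d₀‖H(g)` (★ `distribHaarChar_torus_three`), and the
exponents `‖d₀‖²·‖d₀‖^{−z}·‖d₀‖^{z−2} = 1`.  The N = 3 twin of ★ `isChiSection_intertwinedCoeff_two` (there `H^{z−1}`, `δ_B = ‖d₀‖`); no automorphy of `χ₂` is used.
[cite: MoeglinWaldspurger1995, II.1.6–II.1.7] [cite: Rogawski1990, §1.10 p. 9] [cite: Garrett2018, §2.8] -/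
theorem isChiSectionPair_intertwinedCoeff_three (hc : c * c = 1) (hc1 : c ≠ 1) (ν : Measure ↥(adelicUnipotent F E c 3)) [ν.IsHaarMeasure]
    {χ₁ : HeckeCharacter E} {χ₂ : ↥(TorusDict.torus c) →ₜ* ℂˣ} {φ : (quasiSplit F E c 3).Adelic → ℂ} (hφ : IsChiSectionPair χ₁ χ₂ φ) (hφm : Measurable φ) (z : ℂ) :
    IsChiSectionPair (reflectChar c χ₁) χ₂ (fun g : (quasiSplit F E c 3).Adelic =>
      (∫ v : ↥(adelicUnipotent F E c 3), flatSectionU φ z ((quasiSplit F E c 3).toAdelic (weylLongU (c : E →+* E) (rfl : (StdForm.antidiagonal 3).over E = (StdForm.antidiagonal 3).over E)) *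
        ((v : (quasiSplit F E c 3).Adelic) * g)) ∂ν) * (((borelHeight g : ℝ) : ℂ) ^ (z - 2))) := by
  haveI := locallyCompactSpace_adeleRing' E
  intro b hb g
  dsimp only
  -- Levi `b = t n`
  set tB : ↥(torusInBorel F E c 3) := ⟨torusPart ⟨b, hb⟩, (mem_torusInBorel_iff _).2 (torusPart_mem_torusAdelic _)⟩ with htB
  have hd : glDiagonal 3 (AdeleRing (𝓞 E) E) (diagUnit hb) = adelicVal F E c 3 _ ((tB : borelAdelic F E c 3) : (quasiSplit F E c 3).Adelic) := (adelicVal_torusPart ⟨b, hb⟩).symm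
  have hn : (((tB : borelAdelic F E c 3) : (quasiSplit F E c 3).Adelic))⁻¹ * b ∈ adelicUnipotent F E c 3 := torusPart_inv_mul_mem_adelicUnipotent ⟨b, hb⟩
  have hbg : b * g = ((tB : borelAdelic F E c 3) : (quasiSplit F E c 3).Adelic) * (((((tB : borelAdelic F E c 3) : (quasiSplit F E c 3).Adelic))⁻¹ * b) * g) := by group
  -- the integral: torus scaling, then `N(𝔸)`-invariance
  have hI : ∫ v : ↥(adelicUnipotent F E c 3), flatSectionU φ z ((quasiSplit F E c 3).toAdelic (weylLongU (c : E →+* E) (rfl : (StdForm.antidiagonal 3).over E = (StdForm.antidiagonal 3).over E)) *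
        ((v : (quasiSplit F E c 3).Adelic) * (b * g))) ∂ν =
      ((torusRootModulus E 3 (diagUnit hb) : ℝ) : ℂ) * (((χ₁ (diagUnit hb 2) : ℂˣ) : ℂ) * ((χ₂ (middleEntryUnitary (tB : borelAdelic F E c 3).2) : ℂˣ) : ℂ) *
          ((((IdeleClassGroup.ideleNorm E (diagUnit hb 0))⁻¹ : ℝ≥0) : ℝ) : ℂ) ^ z) *
        ∫ v : ↥(adelicUnipotent F E c 3), flatSectionU φ z ((quasiSplit F E c 3).toAdelic (weylLongU (c : E →+* E) (rfl : (StdForm.antidiagonal 3).over E = (StdForm.antidiagonal 3).over E)) *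
          ((v : (quasiSplit F E c 3).Adelic) * g)) ∂ν := by
    rw [hbg, integral_flatSectionU_weylLongU_torus_mul_of_isChiSectionPair hc hc1 ν hφ hφm tB hd z]
    have key := integral_weyl_mul_unipotent_mul_three hc ν (flatSectionU φ z) hn g
    simp_rw [mul_assoc] at key ⊢
    rw [key]
  -- the height: `H(b g) = ‖d₀‖ · H(g)`, and `δ_B(t) = ‖d₀‖²`
  have hδ : (torusRootModulus E 3 (diagUnit hb) : ℝ) = (IdeleClassGroup.ideleNorm E (diagUnit hb 0) : ℝ) * (IdeleClassGroup.ideleNorm E (diagUnit hb 0) : ℝ) := by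
    rw [torusRootModulus_three_eq tB hd, AdeleRing.distribHaarChar_eq_ideleNorm, NNReal.coe_mul]
  have hHb : borelHeight (b * g) = IdeleClassGroup.ideleNorm E (diagUnit hb 0) * borelHeight g := by
    have h2 := (distribHaarChar_torus_three tB hd).2
    rw [AdeleRing.distribHaarChar_eq_ideleNorm, AdeleRing.distribHaarChar_eq_ideleNorm] at h2
    have hlast : lastEntryUnit hb = diagUnit hb 2 := Units.ext rfl
    rw [borelHeight_borel_mul hb, hlast, h2, inv_inv]
  -- the characters: `χ₁(d₂) = χ₁ʷ(d₀)`, `d₀ = b₀₀`; the middle entry of `t` is that of `b`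
  have hχ₁ : χ₁ (diagUnit hb 2) = reflectChar c χ₁ (firstEntryUnit hb) := by
    rw [chi_torus_last_eq_reflectChar χ₁ tB hd]
    rfl
  have hχ₂ : middleEntryUnitary (tB : borelAdelic F E c 3).2 = middleEntryUnitary hb := by
    refine middleEntryUnitary_eq_of_apply_eq (tB : borelAdelic F E c 3).2 hb ?_
    rw [← hd, coe_glDiagonal, Matrix.diagonal_apply_eq]
    rfl
  rw [hI, hδ, hHb, hχ₁, hχ₂]
  -- exponents: `‖d₀‖² · (‖d₀‖⁻¹)^z · (‖d₀‖ H)^{z−2} = H^{z−2}`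
  have hpos : (0 : ℝ) < (IdeleClassGroup.ideleNorm E (diagUnit hb 0) : ℝ) := ideleNorm_real_pos _
  have hH : (0 : ℝ) < (borelHeight g : ℝ) := by exact_mod_cast borelHeight_pos g
  have hne : ((IdeleClassGroup.ideleNorm E (diagUnit hb 0) : ℝ) : ℂ) ≠ 0 := Complex.ofReal_ne_zero.2 hpos.ne'
  have harg : (((IdeleClassGroup.ideleNorm E (diagUnit hb 0) : ℝ) : ℂ)).arg ≠ Real.pi := by
    rw [Complex.arg_ofReal_of_nonneg hpos.le]; exact Real.pi_ne_zero.symm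
  rw [NNReal.coe_mul, Complex.ofReal_mul, Complex.ofReal_mul, Complex.mul_cpow_ofReal_nonneg hpos.le hH.le, NNReal.coe_inv, Complex.ofReal_inv, Complex.inv_cpow _ _ harg]
  have hzz : ((IdeleClassGroup.ideleNorm E (diagUnit hb 0) : ℝ) : ℂ) ^ z ≠ 0 := by
    rw [Ne, Complex.cpow_eq_zero_iff]; exact fun h => hne h.1
  have hsplit : ((IdeleClassGroup.ideleNorm E (diagUnit hb 0) : ℝ) : ℂ) ^ (z - 2) =
      ((IdeleClassGroup.ideleNorm E (diagUnit hb 0) : ℝ) : ℂ) ^ z * ((((IdeleClassGroup.ideleNorm E (diagUnit hb 0) : ℝ) : ℂ)) * ((IdeleClassGroup.ideleNorm E (diagUnit hb 0) : ℝ) : ℂ))⁻¹ := by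
    rw [Complex.cpow_sub _ _ hne, div_eq_mul_inv, show (2 : ℂ) = ((2 : ℕ) : ℂ) by norm_num, Complex.cpow_natCast, pow_two]
  rw [hsplit]
  field_simp

omit [BorelSpace (quasiSplit F E c 3).Adelic] in
/-- **The second clause of the `HasReflectedIntertwining` shape at N = 3**: `∫ f_z(W v g) dν = flatSectionU φ̃ (2 − z) g` with `φ̃ := (M(w₀) f_z)·H^{z−2}` — ★
`K2E1MaassSelbergCMThreeIntertwined.flatSectionU_intertwinedCoeff` (`H^{z−2}·H^{2−z} = 1`) BY NAME, restated next to the head so that a `HasReflectedIntertwiningPair χ₁ χ₂ ν φ φ̃ z`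
(D-S8-3 follow-up) is inhabited by `⟨isChiSectionPair_intertwinedCoeff_three …, flatSectionU_intertwinedCoeff_three_eq …⟩`.  Every `z`. [cite: MoeglinWaldspurger1995, II.1.7] -/
theorem flatSectionU_intertwinedCoeff_three_eq (ν : Measure ↥(adelicUnipotent F E c 3)) (φ : (quasiSplit F E c 3).Adelic → ℂ) (z : ℂ) (g : (quasiSplit F E c 3).Adelic) :
    ∫ v : ↥(adelicUnipotent F E c 3), flatSectionU φ z ((quasiSplit F E c 3).toAdelic (weylLongU (c : E →+* E) (rfl : (StdForm.antidiagonal 3).over E = (StdForm.antidiagonal 3).over E)) *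
        (v : (quasiSplit F E c 3).Adelic) * g) ∂ν =
      flatSectionU (fun g : (quasiSplit F E c 3).Adelic =>
        (∫ v : ↥(adelicUnipotent F E c 3), flatSectionU φ z ((quasiSplit F E c 3).toAdelic (weylLongU (c : E →+* E) (rfl : (StdForm.antidiagonal 3).over E = (StdForm.antidiagonal 3).over E)) *
          ((v : (quasiSplit F E c 3).Adelic) * g)) ∂ν) * (((borelHeight g : ℝ) : ℂ) ^ (z - 2))) (2 - z) g := by
  rw [flatSectionU_intertwinedCoeff ν φ z g]
  simp_rw [mul_assoc]

end Scaling

end Summit.HodgeConjecture.HodgeConjecture.Cruxes.H413.K2E1ChiIntertwinedSectionU3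

end
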